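import Summits.Ventures.CertifiedArithmetic.LowPrec.GemmThetaCertificate
import Summits.Ventures.CertifiedArithmetic.LowPrec.GemmThetaE2M1Data2
import Summits.Ventures.CertifiedArithmetic.LowPrec.GemmTieChains

/-!
# Prop. Θ(i) for E2M1²→bfloat16, kernel-checked: `1 - W(n) ≥ 210/(8n + 2625)` for every `n`

HONEST FRAMING (venture CertifiedArithmetic / cell `pub-lowprec`, seat gemm, gen 6): certified error
envelopes and provably optimal rounding/accumulation schemes for low-precision formats under stated
cost models; every table by two implementations; no hardware or vendor claims.

Paper `gemm.tex` §Regimes, Prop. "the terminal constant bounds the defect for every n" (i), instance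
E2M1·E2M1 products accumulated sequentially in `bfloat16` under round-to-nearest-even (the cell's
model `seqSum`; letters `piE2M1`).  The kernel-checked Boolean certificate of
`GemmThetaE2M1Data{,2}.lean` (2 · 1281 states × 37 letters, potential `Φ`, constants `θ = 105/4`,
`ρ = 7/2`, `β_pair = 23/2`, `κ = 4/105`) is turned into a `ThetaCertificate` (`thetaCert_E2M1_BFloat16`)
through the quarter-grid bridge `toRat_roundNE_BFloat16_quarter`, and the generic soundness theorem
`ThetaCertificate.defect_bound` then gives, for EVERY input `x 0 … x m` of letters and every `m`
(`n = m + 1` terms, `Σ|x j| > 0`):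
`210/(8n + 2625) ≤ 1 - (ŝ_m - Σ x)/Σ|x|` (`defect_bound_E2M1_BFloat16`) and the two-sided form
`|ŝ_m - Σ x| ≤ (1 - 210/(8n + 2625)) Σ|x|` (`abs_err_le_E2M1_BFloat16`, by the mirror symmetry of
RNE).  This is the first kernel-checked UPPER bound on the worst-case relative error `W(n)` of this
configuration valid for all `n` (the lower bounds `W(n) ≥ …` are the tie-chain witnesses of
`GemmTerminalE2M1.lean`); previously the constants were two-implementation certificates only.
-/

namespace Literature.ComputerArithmetic.FloatingPoint

namespace MiniFloat

open Finset ThetaE2M1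

/-! ### Sizes and casts -/

/-- Every state magnitude is at most `4 · 16384`. [cell] -/
theorem ThetaE2M1.valQ_le (i : ℕ) : valQ i ≤ 65536 := by
  unfold valQ
  split_ifs with h1 h2
  · omega
  · have he : (i - 256) / 128 + 1 ≤ 8 := by omega
    calc (128 + (i - 256) % 128) * 2 ^ ((i - 256) / 128 + 1) ≤ 255 * 2 ^ 8 :=
          Nat.mul_le_mul (by omega) (Nat.pow_le_pow_right (by norm_num) he)
      _ ≤ 65536 := by norm_num
  · exact le_rfl

/-- `|sval σ i| = valQ i`. [cell] -/
theorem ThetaE2M1.natAbs_sval (σ : Bool) (i : ℕ) : (sval σ i).natAbs = valQ i := by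
  unfold sval; split <;> simp

/-- Letters have magnitude at most `144 = 4 · 36`. [cell] -/
theorem ThetaE2M1.natAbs_le_of_mem_lamQ {Q : ℤ} (hQ : Q ∈ lamQ) : Q.natAbs ≤ 144 := by
  have h : (lamQ.all fun Q => decide (Q.natAbs ≤ 144)) = true := by decide
  exact of_decide_eq_true (List.all_eq_true.mp h Q hQ)

/-- The bridge applies to every edge: `|V + Q| < 2^32`. [cell] -/
theorem ThetaE2M1.natAbs_add_lt {V Q : ℤ} (hV : V.natAbs ≤ 65536) (hQ : Q.natAbs ≤ 144) :
    (V + Q).natAbs < 2 ^ 32 := by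
  have : (V + Q).natAbs ≤ V.natAbs + Q.natAbs := Int.natAbs_add_le V Q
  norm_num; omega

/-- `piE2M1` is `lamQ / 4`. [cell, gemm.tex §Regimes] -/
theorem ThetaE2M1.piE2M1_eq_map : piE2M1 = lamQ.map (fun Q : ℤ => (Q : ℚ) / 4) := by
  decide +kernel

/-- Every letter of `piE2M1` is `Q/4` with `Q ∈ lamQ`. [cell] -/
theorem ThetaE2M1.exists_of_mem_piE2M1 {q : ℚ} (hq : q ∈ piE2M1) : ∃ Q ∈ lamQ, (Q : ℚ) / 4 = q := by
  rw [piE2M1_eq_map, List.mem_map] at hq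
  exact hq

/-- Quarter-grid equalities are integer equalities. [folklore] -/
theorem quarter_eq_iff {a b : ℤ} : (a : ℚ) / 4 = (b : ℚ) / 4 ↔ a = b := by
  rw [div_left_inj' (by norm_num : (4 : ℚ) ≠ 0), Int.cast_inj]

/-! ### The dictionary: one step, gain, deficit, potential in quarter units -/

/-- `fl_bf16(V/4 + Q/4) = rneQuarter(V + Q)/4`. [GemmQuarterRounding] -/
theorem flStep_quarter {V Q : ℤ} (h : (V + Q).natAbs < 2 ^ 32) :
    flStep Format.BFloat16 ((V : ℚ) / 4) ((Q : ℚ) / 4) = (rneQuarter (V + Q) : ℚ) / 4 := by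
  unfold flStep
  rw [show (V : ℚ) / 4 + (Q : ℚ) / 4 = ((V + Q : ℤ) : ℚ) / 4 by push_cast; ring]
  exact toRat_roundNE_BFloat16_quarter (V + Q) h

/-- The gain in quarter units. [cell] -/
theorem gainOf_quarter {V Q : ℤ} (h : (V + Q).natAbs < 2 ^ 32) :
    gainOf Format.BFloat16 ((V : ℚ) / 4) ((Q : ℚ) / 4) = ((rneQuarter (V + Q) - V - Q : ℤ) : ℚ) / 4 := by
  unfold gainOf; rw [flStep_quarter h]; push_cast; ring

/-- The deficit in quarter units. [cell] -/
theorem deficitOf_quarter {V Q : ℤ} (h : (V + Q).natAbs < 2 ^ 32) :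
    deficitOf Format.BFloat16 ((V : ℚ) / 4) ((Q : ℚ) / 4)
      = (((Q.natAbs : ℤ) - (rneQuarter (V + Q) - V - Q) : ℤ) : ℚ) / 4 := by
  unfold deficitOf
  rw [gainOf_quarter h, abs_div, abs_of_pos (by norm_num : (0 : ℚ) < 4), ← Int.cast_abs,
    ← Int.natCast_natAbs]
  push_cast; ring

/-- THE POTENTIAL as a function on `ℚ`: `Φ(v) = psiZ(4v)/4`. [cell, gemm.tex §Regimes] -/
def psiE (v : ℚ) : ℚ := (psiZ ⌊v * 4⌋ : ℚ) / 4

/-- `Φ(V/4) = psiZ V / 4`. [cell] -/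
theorem psiE_quarter (V : ℤ) : psiE ((V : ℚ) / 4) = (psiZ V : ℚ) / 4 := by
  unfold psiE; rw [div_mul_cancel₀ (V : ℚ) (by norm_num : (4 : ℚ) ≠ 0), Int.floor_intCast]

/-- THE STATE SET: `± valQ i / 4`, `i < 1281`. [cell, gemm.tex §Regimes] -/
def SE (v : ℚ) : Prop := ∃ σ : Bool, ∃ i : ℕ, i < 1281 ∧ v = (sval σ i : ℚ) / 4

/-- A magnitude recognised by the closure check is a state. [cell] -/
theorem SE_of_idx {W : ℤ} (h1 : idxQ W.natAbs < 1281) (h2 : valQ (idxQ W.natAbs) = W.natAbs) :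
    SE ((W : ℚ) / 4) := by
  refine ⟨decide (W < 0), idxQ W.natAbs, h1, ?_⟩
  have : sval (decide (W < 0)) (idxQ W.natAbs) = W := by
    unfold sval; rw [h2]
    by_cases hW : W < 0
    · simp only [hW, decide_true, if_true]; omega
    · simp only [hW, decide_false, Bool.false_eq_true, if_false]; omega
  rw [this]

/-! ### From the chunked Boolean theorems to one statement per edge -/

/-- Every edge of the graph passes `edgeOK`. [cell certificate, kernel-checked in Data{,2}] -/
theorem ThetaE2M1.edge_ok (σ : Bool) {i : ℕ} (hi : i < 1281) {Q : ℤ} (hQ : Q ∈ lamQ) :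
    edgeOK σ i Q = true := by
  have H : ∀ a l : ℕ, ((List.range' a l).all fun i => lamQ.all fun Q =>
      edgeOK false i Q && edgeOK true i Q) = true → a ≤ i → i < a + l → edgeOK σ i Q = true := by
    intro a l h ha hl
    have h1 := List.all_eq_true.mp h i (List.mem_range'_1.mpr ⟨ha, hl⟩)
    have h2 := List.all_eq_true.mp h1 Q hQ
    rw [Bool.and_eq_true] at h2
    cases σ
    · exact h2.1
    · exact h2.2
  by_cases c0 : i < 256
  · exact H 0 256 edges_ok_0 (Nat.zero_le _) (by omega)
  by_cases c1 : i < 384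
  · exact H 256 128 edges_ok_256 (by omega) (by omega)
  by_cases c2 : i < 512
  · exact H 384 128 edges_ok_384 (by omega) (by omega)
  by_cases c3 : i < 640
  · exact H 512 128 edges_ok_512 (by omega) (by omega)
  by_cases c4 : i < 768
  · exact H 640 128 edges_ok_640 (by omega) (by omega)
  by_cases c5 : i < 896
  · exact H 768 128 edges_ok_768 (by omega) (by omega)
  by_cases c6 : i < 1024
  · exact H 896 128 edges_ok_896 (by omega) (by omega)
  by_cases c7 : i < 1152
  · exact H 1024 128 edges_ok_1024 (by omega) (by omega)
  by_cases c8 : i < 1280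
  · exact H 1152 128 edges_ok_1152 (by omega) (by omega)
  exact H 1280 1 edges_ok_1280 (by omega) (by omega)

/-- What `edgeOK = true` says, as propositions. [cell] -/
theorem ThetaE2M1.edgeOK_cases {σ : Bool} {i : ℕ} {Q : ℤ} (h : edgeOK σ i Q = true) :
    (WQ σ i Q = sval σ i ∧ (0 ≤ Q ∨ 105 * -Q ≤ 4 * psiZ (sval σ i))) ∨
    (WQ σ i Q ≠ sval σ i ∧ idxQ (WQ σ i Q).natAbs < 1281 ∧
      valQ (idxQ (WQ σ i Q).natAbs) = (WQ σ i Q).natAbs ∧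
      psiZ (WQ σ i Q) ≤ psiZ (sval σ i) + defQ σ i Q ∧
      ((0 < defQ σ i Q ∧ 2 * gainQ σ i Q ≤ 7 * defQ σ i Q) ∨
       (¬ 0 < defQ σ i Q ∧ 105 * gainQ σ i Q ≤ 4 * psiZ (sval σ i) ∧
          pairOK (WQ σ i Q) (gainQ σ i Q) = true))) := by
  unfold edgeOK at h
  split_ifs at h with hWV hd
  · simp only [Bool.or_eq_true, decide_eq_true_eq] at h
    exact Or.inl ⟨hWV, h⟩
  · simp only [Bool.and_eq_true, decide_eq_true_eq] at h
    exact Or.inr ⟨hWV, h.1.1.1, h.1.1.2, h.1.2, Or.inl ⟨hd, h.2⟩⟩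
  · simp only [Bool.and_eq_true, decide_eq_true_eq] at h
    exact Or.inr ⟨hWV, h.1.1.1, h.1.1.2, h.1.2, Or.inr ⟨hd, h.2.1, h.2.2⟩⟩

/-- What `pairOK = true` says for one letter. [cell] -/
theorem ThetaE2M1.pairOK_sound {W δf Q' : ℤ} (h : pairOK W δf = true) (hQ' : Q' ∈ lamQ) :
    rneQuarter (W + Q') = W ∨
      2 * (δf + (rneQuarter (W + Q') - W - Q')) ≤ 23 * ((Q'.natAbs : ℤ) - (rneQuarter (W + Q') - W - Q')) := by
  have h1 := List.all_eq_true.mp h Q' hQ'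
  simp only [Bool.or_eq_true, decide_eq_true_eq] at h1
  exact h1

/-! ### The certificate -/

/-- THE θ-CERTIFICATE OF E2M1²→bfloat16 (RNE, sequential): letters `piE2M1`, states `SE`, potential
`psiE`, `θ = 105/4`, `ρ = 7/2`, `β_pair = 23/2`, `κ = 4/105`. [cell certificate, kernel-checked] -/
theorem thetaCert_E2M1_BFloat16 :
    ThetaCertificate Format.BFloat16 (fun q => q ∈ piE2M1) SE psiE (105 / 4) (7 / 2) (23 / 2) (4 / 105) where
  θ_pos := by norm_num
  ρ_nonneg := by norm_num
  βp_nonneg := by norm_num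
  κ_nonneg := by norm_num
  start := by
    intro q hq
    obtain ⟨Q, hQ, rfl⟩ := exists_of_mem_piE2M1 hq
    have hb := natAbs_le_of_mem_lamQ hQ
    have hs := List.all_eq_true.mp starts_ok Q hQ
    unfold startOK at hs
    simp only [Bool.and_eq_true, decide_eq_true_eq] at hs
    obtain ⟨⟨h1, h2⟩, h3⟩ := hs
    refine ⟨exists_toRat_eq_quarter (by omega), SE_of_idx h1 h2, ?_⟩
    rw [psiE_quarter, abs_div, abs_of_pos (by norm_num : (0 : ℚ) < 4), ← Int.cast_abs,
      ← Int.natCast_natAbs]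
    have : ((psiZ Q : ℤ) : ℚ) ≤ ((Q.natAbs : ℤ) : ℚ) := by exact_mod_cast h3
    linarith
  closed := by
    rintro v q ⟨σ, i, hi, rfl⟩ hq
    obtain ⟨Q, hQ, rfl⟩ := exists_of_mem_piE2M1 hq
    have hb := natAbs_add_lt ((natAbs_sval σ i).le.trans (valQ_le i)) (natAbs_le_of_mem_lamQ hQ)
    rw [flStep_quarter hb]
    rcases edgeOK_cases (edge_ok σ hi hQ) with ⟨hWV, -⟩ | ⟨-, h1, h2, -, -⟩
    · unfold WQ at hWV; rw [hWV]; exact ⟨σ, i, hi, rfl⟩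
    · exact SE_of_idx h1 h2
  potential := by
    rintro v q ⟨σ, i, hi, rfl⟩ hq hne
    obtain ⟨Q, hQ, rfl⟩ := exists_of_mem_piE2M1 hq
    have hb := natAbs_add_lt ((natAbs_sval σ i).le.trans (valQ_le i)) (natAbs_le_of_mem_lamQ hQ)
    rw [flStep_quarter hb] at hne ⊢
    rw [psiE_quarter, psiE_quarter, deficitOf_quarter hb]
    rcases edgeOK_cases (edge_ok σ hi hQ) with ⟨hWV, -⟩ | ⟨-, -, -, h3, -⟩
    · unfold WQ at hWV; exact absurd (quarter_eq_iff.mpr hWV) hne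
    · unfold defQ gainQ WQ at h3
      have h3' : ((psiZ (rneQuarter (sval σ i + Q)) : ℤ) : ℚ)
          ≤ ((psiZ (sval σ i) + ((Q.natAbs : ℤ) - (rneQuarter (sval σ i + Q) - sval σ i - Q)) : ℤ) : ℚ) := by
        exact_mod_cast h3
      push_cast at h3' ⊢
      linarith
  capacity := by
    rintro v q ⟨σ, i, hi, rfl⟩ hq habs hneg
    obtain ⟨Q, hQ, rfl⟩ := exists_of_mem_piE2M1 hq
    have hb := natAbs_add_lt ((natAbs_sval σ i).le.trans (valQ_le i)) (natAbs_le_of_mem_lamQ hQ)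
    rw [flStep_quarter hb, quarter_eq_iff] at habs
    have hQ0 : Q < 0 := by
      have : (Q : ℚ) < 0 := by linarith
      exact_mod_cast this
    rw [psiE_quarter]
    rcases edgeOK_cases (edge_ok σ hi hQ) with ⟨-, hcap⟩ | ⟨hWV, -⟩
    · rcases hcap with h | h
      · omega
      · have h' : ((105 * -Q : ℤ) : ℚ) ≤ ((4 * psiZ (sval σ i) : ℤ) : ℚ) := by exact_mod_cast h
        push_cast at h'
        linarith
    · exact absurd habs hWV
  paid := by
    rintro v q ⟨σ, i, hi, rfl⟩ hq hne hpos
    obtain ⟨Q, hQ, rfl⟩ := exists_of_mem_piE2M1 hq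
    have hb := natAbs_add_lt ((natAbs_sval σ i).le.trans (valQ_le i)) (natAbs_le_of_mem_lamQ hQ)
    rw [flStep_quarter hb] at hne
    rw [deficitOf_quarter hb] at hpos ⊢
    rw [gainOf_quarter hb]
    have hpos' : (0 : ℤ) < (Q.natAbs : ℤ) - (rneQuarter (sval σ i + Q) - sval σ i - Q) := by
      have : (0 : ℚ) < (((Q.natAbs : ℤ) - (rneQuarter (sval σ i + Q) - sval σ i - Q) : ℤ) : ℚ) := by
        linarith
      exact_mod_cast this
    rcases edgeOK_cases (edge_ok σ hi hQ) with ⟨hWV, -⟩ | ⟨-, -, -, -, hmv⟩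
    · unfold WQ at hWV; exact absurd (quarter_eq_iff.mpr hWV) hne
    · rcases hmv with ⟨-, h⟩ | ⟨hd, -, -⟩
      · unfold defQ gainQ WQ at h
        have h' : ((2 * (rneQuarter (sval σ i + Q) - sval σ i - Q) : ℤ) : ℚ)
            ≤ ((7 * ((Q.natAbs : ℤ) - (rneQuarter (sval σ i + Q) - sval σ i - Q)) : ℤ) : ℚ) := by
          exact_mod_cast h
        push_cast at h' ⊢
        linarith
      · unfold defQ gainQ WQ at hd; exact absurd hpos' hd
  free := by
    rintro v q ⟨σ, i, hi, rfl⟩ hq hne hd0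
    obtain ⟨Q, hQ, rfl⟩ := exists_of_mem_piE2M1 hq
    have hb := natAbs_add_lt ((natAbs_sval σ i).le.trans (valQ_le i)) (natAbs_le_of_mem_lamQ hQ)
    rw [flStep_quarter hb] at hne ⊢
    rw [deficitOf_quarter hb] at hd0
    rw [gainOf_quarter hb, psiE_quarter]
    have hd0' : (Q.natAbs : ℤ) - (rneQuarter (sval σ i + Q) - sval σ i - Q) = 0 := by
      have : ((((Q.natAbs : ℤ) - (rneQuarter (sval σ i + Q) - sval σ i - Q)) : ℤ) : ℚ) = 0 := by
        linarith
      exact_mod_cast this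
    rcases edgeOK_cases (edge_ok σ hi hQ) with ⟨hWV, -⟩ | ⟨-, h1, h2, -, hmv⟩
    · unfold WQ at hWV; exact absurd (quarter_eq_iff.mpr hWV) hne
    rcases hmv with ⟨hd, -⟩ | ⟨-, hκ, hpair⟩
    · unfold defQ gainQ WQ at hd; omega
    unfold gainQ WQ at hκ hpair
    refine ⟨?_, ?_⟩
    · have h' : ((105 * (rneQuarter (sval σ i + Q) - sval σ i - Q) : ℤ) : ℚ)
          ≤ ((4 * psiZ (sval σ i) : ℤ) : ℚ) := by exact_mod_cast hκ
      push_cast at h' ⊢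
      linarith
    · intro q' hq' hne'
      obtain ⟨Q', hQ', rfl⟩ := exists_of_mem_piE2M1 hq'
      have hW : (rneQuarter (sval σ i + Q)).natAbs ≤ 65536 := by
        unfold WQ at h2; rw [← h2]; exact valQ_le _
      have hb' := natAbs_add_lt hW (natAbs_le_of_mem_lamQ hQ')
      rw [flStep_quarter hb'] at hne'
      rw [gainOf_quarter hb', deficitOf_quarter hb']
      rcases pairOK_sound hpair hQ' with h | h
      · exact absurd (by rw [h]) hne'
      · have h' : ((2 * ((rneQuarter (sval σ i + Q) - sval σ i - Q)
              + (rneQuarter (rneQuarter (sval σ i + Q) + Q') - rneQuarter (sval σ i + Q) - Q')) : ℤ) : ℚ)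
            ≤ ((23 * ((Q'.natAbs : ℤ) - (rneQuarter (rneQuarter (sval σ i + Q) + Q')
              - rneQuarter (sval σ i + Q) - Q')) : ℤ) : ℚ) := by
          exact_mod_cast h
        push_cast at h' ⊢
        linarith

/-! ### The bound -/

/-- PROP. Θ(i) FOR E2M1²→bfloat16, KERNEL-CHECKED: for every input of E2M1·E2M1 products
`x 0, …, x m` (`n = m + 1` terms, not all zero) accumulated sequentially in `bfloat16` (RNE),
`210/(8n + 2625) ≤ 1 - (ŝ_m - Σ x)/Σ|x|`. [cell, gemm.tex §Regimes Prop. Θ(i) — now a theorem] -/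
theorem defect_bound_E2M1_BFloat16 (x : ℕ → ℚ) (hx : ∀ j, x j ∈ piE2M1) (m : ℕ)
    (hL : 0 < ∑ j ∈ range (m + 1), |x j|) :
    210 / (8 * (m + 1) + 2625)
      ≤ 1 - ((seqSum Format.BFloat16 x m).toRat - ∑ j ∈ range (m + 1), x j)
          / ∑ j ∈ range (m + 1), |x j| := by
  have h := thetaCert_E2M1_BFloat16.defect_bound x hx m hL
  rw [show max (7 / 2 : ℚ) (23 / 2) + 4 / 105 = 2423 / 210 by norm_num,
    theta_bound_E2M1_BFloat16_const] at h
  exact h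

/-- The letters are closed under negation. [folklore] -/
theorem neg_mem_piE2M1 {q : ℚ} (hq : q ∈ piE2M1) : -q ∈ piE2M1 := by
  have h : (piE2M1.all fun p => decide (-p ∈ piE2M1)) = true := by decide +kernel
  exact of_decide_eq_true (List.all_eq_true.mp h q hq)

/-- RNE accumulation is odd: `ŝ(-x) = -ŝ(x)`. [folklore] -/
theorem toRat_seqSum_neg (α : Format) (x : ℕ → ℚ) :
    ∀ m, (seqSum α (fun j => -x j) m).toRat = -(seqSum α x m).toRat
  | 0 => by simp [seqSum, toRat_roundNE_neg]
  | m + 1 => by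
      simp only [seqSum]
      rw [toRat_seqSum_neg α x m, ← neg_add, toRat_roundNE_neg]

/-- TWO-SIDED FORM: `|ŝ_m - Σ x| ≤ (1 - 210/(8n + 2625)) · Σ|x|` for every input of E2M1·E2M1
products into `bfloat16`, i.e. `W(n) ≤ 1 - 210/(8n + 2625) = (8n + 2415)/(8n + 2625)` for the
worst-case relative error of this configuration — an upper bound valid for every `n`, to be read
against the tie-chain lower bounds of `GemmTerminalE2M1.lean`. [cell, gemm.tex §Regimes Prop. Θ(i)] -/
theorem abs_err_le_E2M1_BFloat16 (x : ℕ → ℚ) (hx : ∀ j, x j ∈ piE2M1) (m : ℕ) :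
    |(seqSum Format.BFloat16 x m).toRat - ∑ j ∈ range (m + 1), x j|
      ≤ (1 - 210 / (8 * (m + 1) + 2625)) * ∑ j ∈ range (m + 1), |x j| := by
  by_cases hL : ∑ j ∈ range (m + 1), |x j| = 0
  · -- all terms vanish
    have hz : ∀ j ∈ range (m + 1), x j = 0 := by
      intro j hj
      have := (sum_eq_zero_iff_of_nonneg fun i _ => abs_nonneg (x i)).mp hL j hj
      exact abs_eq_zero.mp this
    have hs : ∀ k ≤ m, (seqSum Format.BFloat16 x k).toRat = 0 := by
      intro k hk
      induction k with
      | zero => simp [seqSum, hz 0 (by simp), toRat_roundNE_zero]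
      | succ k ih =>
          simp only [seqSum]
          rw [ih (by omega), hz (k + 1) (mem_range.mpr (by omega)), add_zero, toRat_roundNE_zero]
    rw [hs m le_rfl, sum_eq_zero hz, hL]; simp
  · have hpos : 0 < ∑ j ∈ range (m + 1), |x j| :=
      lt_of_le_of_ne (sum_nonneg fun i _ => abs_nonneg (x i)) (Ne.symm hL)
    have hc : (0 : ℚ) ≤ 1 - 210 / (8 * (m + 1) + 2625) := by
      rw [sub_nonneg, div_le_one (by positivity)]; linarith [show (0 : ℚ) ≤ m from Nat.cast_nonneg m]
    have h1 := defect_bound_E2M1_BFloat16 x hx m hpos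
    have hx' : ∀ j, (fun j => -x j) j ∈ piE2M1 := fun j => neg_mem_piE2M1 (hx j)
    have h2 := defect_bound_E2M1_BFloat16 (fun j => -x j) hx' m (by simpa using hpos)
    simp only [abs_neg, sum_neg_distrib, toRat_seqSum_neg] at h2
    rw [abs_le]
    constructor
    · have := (le_sub_comm.mp h2)
      rw [div_le_iff₀ hpos] at this
      linarith
    · have := (le_sub_comm.mp h1)
      rw [div_le_iff₀ hpos] at this
      linarith

/-- THE GEMM PHRASING: for every `n = m + 1` pairs of E2M1 data `a j, b j` (exact products,
accumulated sequentially in `bfloat16`, RNE) the inner-product error satisfies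
`|ŝ - Σ a_j b_j| ≤ (1 - 210/(8n + 2625)) · Σ|a_j b_j|`. [cell, gemm.tex §Regimes Prop. Θ(i)] -/
theorem abs_dot_err_le_E2M1_BFloat16 (a b : ℕ → MiniFloat Format.E2M1) (m : ℕ) :
    |(seqSum Format.BFloat16 (fun j => (a j).toRat * (b j).toRat) m).toRat
        - ∑ j ∈ range (m + 1), (a j).toRat * (b j).toRat|
      ≤ (1 - 210 / (8 * (m + 1) + 2625)) * ∑ j ∈ range (m + 1), |(a j).toRat * (b j).toRat| :=
  abs_err_le_E2M1_BFloat16 _ (fun j => mul_mem_piE2M1 (a j) (b j)) m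

end MiniFloat

end Literature.ComputerArithmetic.FloatingPoint
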